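import Mathlib
import Summits.KontsevichZagierPeriods.Zeta5Search.ClusterValuation
import Summits.KontsevichZagierPeriods.Zeta5Search.PalindromicClassBounds
import Summits.KontsevichZagierPeriods.Zeta5Search.PalindromicClassBoundsProof
import Summits.KontsevichZagierPeriods.Zeta5Search.CasoratianClassBoundProof
import Summits.KontsevichZagierPeriods.Zeta5Search.MixedPairTermwiseProof
import Summits.KontsevichZagierPeriods.Zeta5Search.DenomLaw.OrbitCreditCasoratian

/-!
# ζ(5) search — DENOM-LAW: the threshold model, PART VI (THEOREM LB with rung K's rows), part A: `rowMinK`, `LB_K = VB + rowMinK`, `LB_K⁺` (general, tree-level = `CasoratianKDev.lean`)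

Cell `pub-zeta5`, track DENOM-LAW (K1 typing order item (1), «ThresholdModel port»): denom-engine-d2 g16's kernel-checked scratch module
`denom-law/engine-d2/g16/lean/LevelCensusCasoratianK.lean` PART VI (THRESHOLD-X8; general half = `CasoratianKDev.lean`) filed VERBATIM in two parts by denom-prover-d1 g5.  Part A of 2 (= 21st file of the port; imports tree modules only, independent of the chain).
HONEST FRAMING: systematic search; MODEL-side level combinatorics read against the tree's THEOREM LB / rung K / orbit bounds on deep cells; nothing about ζ(5); no γ; no irrationality claim; records in print UNMOVED.
The mathematical header of PART VI (engine-d2 g16's) is the second module docstring of part B (`ThresholdModelCasoratianKDeep.lean`).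
-/

namespace Summit.KontsevichZagierPeriods.Zeta5Search.DenomLaw.ThresholdModel.Rho

section CasoratianK

open Finset
open Summit.KontsevichZagierPeriods.Zeta5Search.ClusterValuation (classSet classExp classPoleCount classNu netExp CentreIn
  classConfig IsPalindromic classBound classRowList classRowListPal vbMin rowMin casLB classK classV kRes omegaRes tameSingle
  palUnit coeffV_eq_sum_classV kRes_eq_sum_classK casoratian_split classK_eq_zero_of_noPole classV_eq_zero_of_noPole
  padicNorm_coeffV_le padicNorm_classK_le_multi padicNorm_classK_le_single padicNorm_classK_le_pal
  padicNorm_classK_shift_le_pal vbMin_le vbMin_isSome classNu_shift_ge classPoleCount_shift_le classExp_shift_ge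
  omegaRes_eq_zero padicNorm_omegaRes_le_one padicNorm_mul_le exists_classExp_le_of_mul_lt classExp_nonneg_of_noPole
  val_ge_of_padicNorm_le rowMin_le_one rowMin_le_multi rowMin_le_zero rowMin_isSome casoratianClassBound_holds)
open Summit.KontsevichZagierPeriods.Zeta5Search.ClusterValuation.Orbit (vbPlus casLBPlus classNuPlus vbPlus_isSome
  le_classNuPlus_of_vbPlus padicNorm_coeffV_le_plus classNuPlus_shift_ge casoratianOrbitBound_holds classNu_le_classNuPlus)
open Summit.KontsevichZagierPeriods.Zeta5Search.CasoratianValuation (InPolytope pairFloors refund shift casoratian)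
open Summit.KontsevichZagierPeriods.Zeta5Search.WedgeDictionary (dOf coeffW coeffU coeffV)
open Summit.KontsevichZagierPeriods.Zeta5Search.PadicSeries (one_le_p zpow_p_nonneg)
open Summit.KontsevichZagierPeriods.Zeta5Search.DualSeries (InBox)
open Summit.KontsevichZagierPeriods.Zeta5Search.BigPrime (shift_zero dOf_shift)

/-! ### (X8-1) THEOREM LB WITH RUNG K's ROWS: `rowMinK`, `LB_K = VB + rowMinK`, `LB_K⁺ = VB⁺ + rowMinK` -/

/-- THEOREM LB's row term with rung K's multipole rows: `min{1 [single-pole class], T_x(3) [multipole class], 0 [p > d]}`,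
`T_x(3) = classBound b p x 3 = 3 + E_x + [configuration palindromic ∧ 3 + E_x odd]` — the tree's `rowMin` with census g13's
rung-K list `classRowListPal b p 3` (`PalindromicClassBounds`) in place of rung M's `classRowList b p 3`. -/
def rowMinK (b : ℕ → ℤ) (p : ℕ) : Option ℤ :=
  (classRowListPal b p 3 ++ (if dOf b < (p : ℤ) then [0] else [])).min?

/-- **`LB_K(b,p) = VB + rowMinK`** (`0` if there is no pole class): THEOREM LB's `casLB` with the palindrome bonus on the
`𝒦`-rows. -/
def casLBK (b : ℕ → ℤ) (p : ℕ) : ℤ :=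
  match vbMin b p, rowMinK b p with
  | some v, some r => v + r
  | _, _ => 0

/-- **`LB_K⁺(b,p) = VB⁺ + rowMinK`**: both digit-free credits at once — the reflection-orbit credit of the tree's
`DenomLaw/OrbitCredit` on the two constant terms (`vbPlus`) and the palindrome bonus on the `𝒦`-rows. -/
def casLBKPlus (b : ℕ → ℤ) (p : ℕ) : ℤ :=
  match vbPlus b p, rowMinK b p with
  | some v, some r => v + r
  | _, _ => 0

variable {p : ℕ}

/-- Reading the row list of `rowMinK`. -/
theorem mem_rowListK (b : ℕ → ℤ) {x : ℕ} (hx : x < p) {z : ℤ}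
    (hz : (if classPoleCount b p x = 1 then some 1
      else if 2 ≤ classPoleCount b p x then some (classBound b p x 3) else none) = some z) :
    z ∈ classRowListPal b p 3 ++ (if dOf b < (p : ℤ) then [0] else []) := by
  refine List.mem_append.2 (Or.inl ?_)
  unfold classRowListPal
  exact List.mem_filterMap.2 ⟨x, List.mem_range.2 hx, hz⟩

/-- `rowMinK ≤ 1` when some class has exactly one pole. -/
theorem rowMinK_le_one_of_single (b : ℕ → ℤ) {r : ℤ} (h : rowMinK b p = some r) {x : ℕ} (hx : x < p)
    (hone : classPoleCount b p x = 1) : r ≤ 1 :=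
  (List.min?_eq_some_iff.1 h).2 _ (mem_rowListK b hx (by rw [if_pos hone]))

/-- `rowMinK ≤ T_x(3)` for every multipole class. -/
theorem rowMinK_le_classBound (b : ℕ → ℤ) {r : ℤ} (h : rowMinK b p = some r) {x : ℕ} (hx : x < p)
    (htwo : 2 ≤ classPoleCount b p x) : r ≤ classBound b p x 3 :=
  (List.min?_eq_some_iff.1 h).2 _ (mem_rowListK b hx (by rw [if_neg (by omega), if_pos htwo]))

/-- `rowMinK ≤ 0` beyond the excess (`p > d(b)`). -/
theorem rowMinK_le_zero (b : ℕ → ℤ) {r : ℤ} (h : rowMinK b p = some r) (hd : dOf b < (p : ℤ)) : r ≤ 0 :=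
  (List.min?_eq_some_iff.1 h).2 _ (List.mem_append.2 (Or.inr (by rw [if_pos hd]; simp)))

/-- If some class has a pole, `rowMinK` is defined. -/
theorem rowMinK_isSome (b : ℕ → ℤ) {x : ℕ} (hx : x < p) (hpole : 1 ≤ classPoleCount b p x) :
    ∃ r, rowMinK b p = some r := by
  have hz : ∃ z : ℤ, (if classPoleCount b p x = 1 then some (1 : ℤ)
      else if 2 ≤ classPoleCount b p x then some (classBound b p x 3) else none) = some z := by
    by_cases h1 : classPoleCount b p x = 1
    · exact ⟨1, by rw [if_pos h1]⟩
    · exact ⟨classBound b p x 3, by rw [if_neg h1, if_pos (by omega)]⟩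
  obtain ⟨z, hz⟩ := hz
  have hmem := mem_rowListK b hx hz
  unfold rowMinK
  rcases h : (classRowListPal b p 3 ++ (if dOf b < (p : ℤ) then [0] else [])).min? with _ | r
  · rw [List.min?_eq_none_iff] at h
    rw [h] at hmem
    simp at hmem
  · exact ⟨r, h⟩

/-- **`rowMinK ≤ 1` ALWAYS** (in the polytope, `p ≥ 5` prime): beyond the excess the refund entry is `0`; for `p ≤ d` the degree
count `Σ_x E_x = −(2d+5)` (`exists_classExp_le_of_mul_lt`) gives a class with `E_x ≤ −3`, whose row is `1` or `T_x(3) ≤ 1`. -/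
theorem rowMinK_le_one [Fact p.Prime] (b : ℕ → ℤ) (hb : InPolytope b) (hp5 : 5 ≤ p) {r : ℤ} (h : rowMinK b p = some r) :
    r ≤ 1 := by
  by_cases hpd : dOf b < (p : ℤ)
  · exact (rowMinK_le_zero b h hpd).trans zero_le_one
  · obtain ⟨x, hx, hE⟩ := exists_classExp_le_of_mul_lt b hb hp5 2 (by push_cast; omega)
    rcases Nat.lt_trichotomy (classPoleCount b p x) 1 with h0 | h1 | h2
    · have := classExp_nonneg_of_noPole b (by omega : classPoleCount b p x = 0); omega
    · exact rowMinK_le_one_of_single b h hx h1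
    · refine (rowMinK_le_classBound b h hx (by omega)).trans ?_
      unfold classBound
      rw [if_pos (by omega)]
      split_ifs <;> push_cast <;> omega

/-- For `p > b₀` no residue class has two points, let alone two poles. -/
theorem classPoleCount_le_one_of_lt (b : ℕ → ℤ) {x : ℕ} (hp : 0 < p) (hpb : b 0 < (p : ℤ)) :
    classPoleCount b p x ≤ 1 := by
  unfold classPoleCount
  refine (card_le_card (filter_subset _ _)).trans (Finset.card_le_one.2 fun s hs t ht => ?_)
  have hbn : (b 0).toNat < p := by omega
  simp only [classSet, mem_filter, mem_range] at hs ht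
  have hs' : s < p := lt_of_lt_of_le hs.1 hbn
  have ht' : t < p := lt_of_lt_of_le ht.1 hbn
  have h1 := hs.2
  have h2 := ht.2
  rw [Nat.mod_eq_of_lt hs'] at h1
  rw [Nat.mod_eq_of_lt ht'] at h2
  rw [h1, h2]

/-- `rowMin ≤ rowMinK`: rung K's rows only raise THEOREM LB's row term (`T_x(3) ≥ 3 + E_x`). -/
theorem rowMin_le_rowMinK (b : ℕ → ℤ) {r r' : ℤ} (h : rowMin b p = some r) (h' : rowMinK b p = some r') : r ≤ r' := by
  obtain ⟨hmem, -⟩ := List.min?_eq_some_iff.1 h'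
  rcases List.mem_append.1 hmem with hz | hz
  · unfold classRowListPal at hz
    obtain ⟨x, hxp, hfx⟩ := List.mem_filterMap.1 hz
    have hx := List.mem_range.1 hxp
    split_ifs at hfx with h1 h2
    · cases hfx; exact rowMin_le_one b h hx h1
    · cases hfx
      refine (rowMin_le_multi b h hx h2).trans ?_
      unfold classBound; rw [if_pos h2]; split_ifs <;> push_cast <;> omega
  · have hd : dOf b < (p : ℤ) := by
      by_contra hnd; rw [if_neg hnd] at hz; simp at hz
    have hz0 : r' = 0 := by rw [if_pos hd] at hz; simpa using hz
    rw [hz0]; exact rowMin_le_zero b h hd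

/-- **THE ROW BOUNDS**: with `r = rowMinK(b,p)`, every class piece `𝒦_x` of `b` AND of `b + e_j` has `‖𝒦_x‖_p ≤ p^{−r}` —
single-pole classes by Theorem A′, multipole classes by the tree's palindromic `𝒦`-class bound for `b` (`padicNorm_classK_le_pal`)
and for `b + e_j` (`padicNorm_classK_shift_le_pal`: an unhit class keeps its configuration, a hit one gains a unit of exponent);
the one configuration where `T_x(3)` exceeds `3 + E_x + palUnit` (palindromic with `E_x` even `≥ −2`) has `3 + E_x ≥ 1 ≥ r`. -/
theorem padicNorm_classK_le_rowK [Fact p.Prime] (b : ℕ → ℤ) {j : ℕ} (hb : InPolytope b) (hj1 : 1 ≤ j)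
    (hb' : InPolytope (shift b j)) (hp5 : 5 ≤ p) (hwin : (b 0 + 2 : ℤ) < (p : ℤ) ^ 2) {r : ℤ} (hr : rowMinK b p = some r)
    {x : ℕ} (hx : x < p) :
    padicNorm p (classK b p x) ≤ (p : ℚ) ^ (-r) ∧ padicNorm p (classK (shift b j) p x) ≤ (p : ℚ) ^ (-r) := by
  have hr1 : r ≤ 1 := rowMinK_le_one b hb hp5 hr
  have hwin' : (shift b j 0 + 2 : ℤ) < (p : ℤ) ^ 2 := by rw [shift_zero b hj1]; exact hwin
  have hcnt := classPoleCount_shift_le b hb.1 hj1 p x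
  rcases Nat.lt_trichotomy (classPoleCount b p x) 1 with hc | hc | hc
  · have h0 : classPoleCount b p x = 0 := by omega
    have h0s : classPoleCount (shift b j) p x = 0 := by omega
    rw [classK_eq_zero_of_noPole b hb h0, classK_eq_zero_of_noPole _ hb' h0s, padicNorm.zero]
    exact ⟨zpow_p_nonneg _, zpow_p_nonneg _⟩
  · have hK : padicNorm p (classK b p x) ≤ (p : ℚ) ^ (-(1 : ℤ)) := padicNorm_classK_le_single b hb hp5 hwin hx hc
    have hK' : padicNorm p (classK (shift b j) p x) ≤ (p : ℚ) ^ (-(1 : ℤ)) := by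
      rcases Nat.eq_zero_or_pos (classPoleCount (shift b j) p x) with h0s | hpos
      · rw [classK_eq_zero_of_noPole _ hb' h0s, padicNorm.zero]; exact zpow_p_nonneg _
      · exact padicNorm_classK_le_single _ hb' hp5 hwin' hx (by omega)
    exact ⟨hK.trans (zpow_le_zpow_right₀ one_le_p (by linarith)),
      hK'.trans (zpow_le_zpow_right₀ one_le_p (by linarith))⟩
  · -- a multipole class: then `p ≤ b₀`, and the palindromic `𝒦`-class bound applies to `b` and to `b + e_j`
    have hpb : (p : ℤ) ≤ b 0 := by
      by_contra hlt
      push Not at hlt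
      have := classPoleCount_le_one_of_lt b (x := x) (Fact.out : p.Prime).pos hlt
      omega
    have hK := padicNorm_classK_le_pal b hb hp5 hpb hwin hx (by omega)
    have hK' := padicNorm_classK_shift_le_pal b hb hj1 hb' hp5 hpb hwin hx (by omega)
    have hle : r ≤ 3 + classExp b p x + palUnit b p x := by
      have hcb := rowMinK_le_classBound b hr hx (by omega)
      unfold classBound at hcb
      rw [if_pos (by omega)] at hcb
      push_cast at hcb
      unfold palUnit
      by_cases hu : IsPalindromic (classConfig b p x) ∧ Even (classExp b p x) ∧ classExp b p x ≤ -4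
      · rw [if_pos hu]
        split_ifs at hcb <;> omega
      · rw [if_neg hu, add_zero]
        split_ifs at hcb with hbonus
        · -- the bonus of `T_x(3)` fires but `palUnit` does not: `E_x` is even and `≥ −2`, so `3 + E_x ≥ 1 ≥ r`
          obtain ⟨k, hk⟩ := hbonus.2
          have heven : Even (classExp b p x) := ⟨k - 1, by omega⟩
          have hE : ¬ classExp b p x ≤ -4 := fun h4 => hu ⟨hbonus.1, heven, h4⟩
          omega
        · omega
    exact ⟨hK.trans (zpow_le_zpow_right₀ one_le_p (by linarith)),
      hK'.trans (zpow_le_zpow_right₀ one_le_p (by linarith))⟩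

/-- **THE ASSEMBLY** (THEOREM LB's proof, `casoratianClassBound_holds`, with the row bounds above): if both constant terms have
`‖V(b)‖, ‖V(b+e_j)‖ ≤ p^{−v}` and `r = rowMinK(b,p)`, then `v_p(Cas_j(b)) ≥ v + r` (`Cas_j = Ω-bracket − 𝒦-bracket`; the
`Ω`-bracket vanishes for `p ≤ d` and is `≥ v` otherwise, where `r ≤ 0`). -/
theorem casoratian_bound_of_rowMinK [hp : Fact p.Prime] (b : ℕ → ℤ) {j : ℕ} (hb : InPolytope b) (hj1 : 1 ≤ j)
    (hj7 : j ≤ 7) (hb' : InPolytope (shift b j)) (hp5 : 5 ≤ p) (hwin : (b 0 + 2 : ℤ) < (p : ℤ) ^ 2) {v r : ℤ}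
    (hVb : padicNorm p (coeffV b) ≤ (p : ℚ) ^ (-v)) (hVb' : padicNorm p (coeffV (shift b j)) ≤ (p : ℚ) ^ (-v))
    (hr : rowMinK b p = some r) (hcas : casoratian b j ≠ 0) : v + r ≤ padicValRat p (casoratian b j) := by
  have hp1 : (1 : ℚ) ≤ p := one_le_p
  have hrow : ∀ x ∈ range p,
      padicNorm p (classK (shift b j) p x * coeffV b - classK b p x * coeffV (shift b j)) ≤ (p : ℚ) ^ (-(v + r)) := by
    intro x hx
    obtain ⟨hK, hK'⟩ := padicNorm_classK_le_rowK b hb hj1 hb' hp5 hwin hr (mem_range.1 hx)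
    refine (padicNorm.sub (p := p)).trans (max_le ?_ ?_)
    · exact (padicNorm_mul_le hK' hVb).trans (zpow_le_zpow_right₀ hp1 (by linarith))
    · exact (padicNorm_mul_le hK hVb').trans (zpow_le_zpow_right₀ hp1 (by linarith))
  have hB : padicNorm p (kRes (shift b j) p * coeffV b - kRes b p * coeffV (shift b j)) ≤ (p : ℚ) ^ (-(v + r)) := by
    rw [kRes_eq_sum_classK (shift b j) hp.out.pos, kRes_eq_sum_classK b hp.out.pos, sum_mul, sum_mul,
      ← sum_sub_distrib]
    exact padicNorm.sum_le' hrow (zpow_p_nonneg _)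
  apply val_ge_of_padicNorm_le hcas
  rw [casoratian_split b j p]
  have hdshift : dOf (shift b j) = dOf b - 1 := dOf_shift b hj1 hj7
  by_cases hpd : (p : ℤ) ≤ dOf b
  · rw [omegaRes_eq_zero b hb (by omega), omegaRes_eq_zero (shift b j) hb' (by rw [hdshift]; omega), zero_mul,
      zero_mul, sub_zero, zero_sub, padicNorm.neg]
    exact hB
  · have hr0 : r ≤ 0 := rowMinK_le_zero b hr (by push Not at hpd; exact_mod_cast hpd)
    refine (padicNorm.sub (p := p)).trans (max_le ?_ hB)
    refine (padicNorm.sub (p := p)).trans (max_le ?_ ?_)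
    · have h1 : padicNorm p (omegaRes (shift b j) p) ≤ (p : ℚ) ^ (0 : ℤ) := by
        simpa using padicNorm_omegaRes_le_one (shift b j) hb' (by omega)
      exact (padicNorm_mul_le h1 hVb).trans (zpow_le_zpow_right₀ hp1 (by linarith))
    · have h1 : padicNorm p (omegaRes b p) ≤ (p : ℚ) ^ (0 : ℤ) := by
        simpa using padicNorm_omegaRes_le_one b hb (by omega)
      exact (padicNorm_mul_le h1 hVb').trans (zpow_le_zpow_right₀ hp1 (by linarith))

/-- **THEOREM LB-K**: `v_p(Cas_j(b)) ≥ LB_K(b,p) = VB + rowMinK` for `b`, `b + e_j` in the Brown–Zudilin polytope and every prime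
`p ≥ 5` with `p² > b₀ + 2` (`Cas_j(b) ≠ 0`).  DIGIT-FREE; dominates THEOREM LB (`casLB_le_casLBK`). -/
theorem casLBK_le_padicValRat_casoratian (b : ℕ → ℤ) {j : ℕ} (hb : InPolytope b) (hj1 : 1 ≤ j) (hj7 : j ≤ 7)
    (hb' : InPolytope (shift b j)) (hprime : p.Prime) (hp5 : 5 ≤ p) (hwin : (b 0 + 2 : ℤ) < (p : ℤ) ^ 2)
    (hcas : casoratian b j ≠ 0) : casLBK b p ≤ padicValRat p (casoratian b j) := by
  haveI : Fact p.Prime := ⟨hprime⟩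
  have hbox : InBox b := hb.1
  have hwin' : (shift b j 0 + 2 : ℤ) < (p : ℤ) ^ 2 := by rw [shift_zero b hj1]; exact hwin
  have hcnt : ∀ x, classPoleCount (shift b j) p x ≤ classPoleCount b p x :=
    fun x => classPoleCount_shift_le b hbox hj1 p x
  by_cases hnone : ∀ x, x < p → classPoleCount b p x = 0
  · exfalso
    apply hcas
    have hV0 : coeffV b = 0 := by
      rw [coeffV_eq_sum_classV b hprime.pos]
      exact sum_eq_zero fun x hx => classV_eq_zero_of_noPole b hb (hnone x (mem_range.1 hx))
    have hV0' : coeffV (shift b j) = 0 := by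
      rw [coeffV_eq_sum_classV (shift b j) hprime.pos]
      refine sum_eq_zero fun x hx => classV_eq_zero_of_noPole _ hb' ?_
      have := hcnt x; have := hnone x (mem_range.1 hx); omega
    unfold casoratian
    rw [hV0, hV0']; ring
  push Not at hnone
  obtain ⟨x₀, hx₀, hc₀⟩ := hnone
  have hpole₀ : 1 ≤ classPoleCount b p x₀ := by omega
  obtain ⟨v, hv⟩ := vbMin_isSome b hx₀ hpole₀
  obtain ⟨r, hr⟩ := rowMinK_isSome b hx₀ hpole₀
  have hLB : casLBK b p = v + r := by simp [casLBK, hv, hr]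
  rw [hLB]
  have hVb : padicNorm p (coeffV b) ≤ (p : ℚ) ^ (-v) :=
    padicNorm_coeffV_le b hb hp5 hwin v fun x hx hpole => vbMin_le b hv hx hpole
  have hVb' : padicNorm p (coeffV (shift b j)) ≤ (p : ℚ) ^ (-v) :=
    padicNorm_coeffV_le (shift b j) hb' hp5 hwin' v fun x hx hpole' =>
      (vbMin_le b hv hx (le_trans hpole' (hcnt x))).trans (classNu_shift_ge b hbox hj1 hpole')
  exact casoratian_bound_of_rowMinK b hb hj1 hj7 hb' hp5 hwin hVb hVb' hr hcas

/-- **THEOREM LB-K⁺**: `v_p(Cas_j(b)) ≥ LB_K⁺(b,p) = VB⁺ + rowMinK` for `5 ≤ p ≤ b₀ < p² − 2` — the orbit credit on the constant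
terms (the tree's `padicNorm_coeffV_le_plus`, `classNuPlus_shift_ge`) together with rung K's rows. -/
theorem casLBKPlus_le_padicValRat_casoratian (b : ℕ → ℤ) {j : ℕ} (hb : InPolytope b) (hj1 : 1 ≤ j) (hj7 : j ≤ 7)
    (hb' : InPolytope (shift b j)) (hprime : p.Prime) (hp5 : 5 ≤ p) (hpb : (p : ℤ) ≤ b 0)
    (hwin : (b 0 + 2 : ℤ) < (p : ℤ) ^ 2) (hcas : casoratian b j ≠ 0) :
    casLBKPlus b p ≤ padicValRat p (casoratian b j) := by
  haveI : Fact p.Prime := ⟨hprime⟩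
  have hp0 : 0 < p := hprime.pos
  have hbox : InBox b := hb.1
  have h0' : shift b j 0 = b 0 := shift_zero b hj1
  have hwin' : (shift b j 0 + 2 : ℤ) < (p : ℤ) ^ 2 := by rw [h0']; exact hwin
  have hpb' : (p : ℤ) ≤ shift b j 0 := by rw [h0']; exact hpb
  have hcnt : ∀ x, classPoleCount (shift b j) p x ≤ classPoleCount b p x :=
    fun x => classPoleCount_shift_le b hbox hj1 p x
  by_cases hnone : ∀ x, x < p → classPoleCount b p x = 0
  · exfalso
    apply hcas
    have hV0 : coeffV b = 0 := by
      rw [coeffV_eq_sum_classV b hprime.pos]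
      exact sum_eq_zero fun x hx => classV_eq_zero_of_noPole b hb (hnone x (mem_range.1 hx))
    have hV0' : coeffV (shift b j) = 0 := by
      rw [coeffV_eq_sum_classV (shift b j) hprime.pos]
      refine sum_eq_zero fun x hx => classV_eq_zero_of_noPole _ hb' ?_
      have := hcnt x; have := hnone x (mem_range.1 hx); omega
    unfold casoratian
    rw [hV0, hV0']; ring
  push Not at hnone
  obtain ⟨x₀, hx₀, hc₀⟩ := hnone
  have hpole₀ : 1 ≤ classPoleCount b p x₀ := by omega
  obtain ⟨v, hv⟩ := vbPlus_isSome b hx₀ hpole₀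
  obtain ⟨r, hr⟩ := rowMinK_isSome b hx₀ hpole₀
  have hLB : casLBKPlus b p = v + r := by simp [casLBKPlus, hv, hr]
  rw [hLB]
  have hvle : ∀ y, y < p → 1 ≤ classPoleCount b p y → v ≤ classNuPlus b p y :=
    fun y hy hpole => le_classNuPlus_of_vbPlus b hv hy hpole
  have hVb : padicNorm p (coeffV b) ≤ (p : ℚ) ^ (-v) := padicNorm_coeffV_le_plus b hb hp5 hpb hwin v hvle
  have hVb' : padicNorm p (coeffV (shift b j)) ≤ (p : ℚ) ^ (-v) :=
    padicNorm_coeffV_le_plus (shift b j) hb' hp5 hpb' hwin' v fun y hy hpole' =>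
      (hvle y hy (le_trans hpole' (hcnt y))).trans (classNuPlus_shift_ge b hbox hj1 hp0 hy hpole')
  exact casoratian_bound_of_rowMinK b hb hj1 hj7 hb' hp5 hwin hVb hVb' hr hcas

/-- `LB ≤ LB_K`. -/
theorem casLB_le_casLBK (b : ℕ → ℤ) {x : ℕ} (hx : x < p) (hpole : 1 ≤ classPoleCount b p x) :
    casLB b p ≤ casLBK b p := by
  obtain ⟨v, hv⟩ := vbMin_isSome b hx hpole
  obtain ⟨r, hr⟩ := rowMin_isSome b hx hpole
  obtain ⟨r', hr'⟩ := rowMinK_isSome b hx hpole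
  have h1 : casLB b p = v + r := by simp [casLB, hv, hr]
  have h2 : casLBK b p = v + r' := by simp [casLBK, hv, hr']
  rw [h1, h2]
  have := rowMin_le_rowMinK b hr hr'
  omega

/-- `LB⁺ ≤ LB_K⁺`. -/
theorem casLBPlus_le_casLBKPlus (b : ℕ → ℤ) {x : ℕ} (hx : x < p) (hpole : 1 ≤ classPoleCount b p x) :
    casLBPlus b p ≤ casLBKPlus b p := by
  obtain ⟨v, hv⟩ := vbPlus_isSome b hx hpole
  obtain ⟨r, hr⟩ := rowMin_isSome b hx hpole
  obtain ⟨r', hr'⟩ := rowMinK_isSome b hx hpole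
  have h1 : casLBPlus b p = v + r := by simp [casLBPlus, hv, hr]
  have h2 : casLBKPlus b p = v + r' := by simp [casLBKPlus, hv, hr']
  rw [h1, h2]
  have := rowMin_le_rowMinK b hr hr'
  omega

/-- `VB ≤ VB⁺`: the orbit credit only raises the `ν_x` (`Orbit.classNu_le_classNuPlus`). -/
theorem vbMin_le_vbPlus (b : ℕ → ℤ) {v v' : ℤ} (hv : vbMin b p = some v) (hv' : vbPlus b p = some v') : v ≤ v' := by
  unfold vbPlus at hv'
  obtain ⟨hmem, -⟩ := List.min?_eq_some_iff.1 hv'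
  obtain ⟨y, hy, hyv⟩ := List.mem_map.1 hmem
  obtain ⟨hyp, hpole⟩ := List.mem_filter.1 hy
  have hy' : y < p := List.mem_range.1 hyp
  have hpole' : 1 ≤ classPoleCount b p y := by simpa using hpole
  rw [← hyv]
  exact (vbMin_le b hv hy' hpole').trans (classNu_le_classNuPlus b p y)

/-- `LB_K ≤ LB_K⁺`. -/
theorem casLBK_le_casLBKPlus (b : ℕ → ℤ) {x : ℕ} (hx : x < p) (hpole : 1 ≤ classPoleCount b p x) :
    casLBK b p ≤ casLBKPlus b p := by
  obtain ⟨v, hv⟩ := vbMin_isSome b hx hpole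
  obtain ⟨v', hv'⟩ := vbPlus_isSome b hx hpole
  obtain ⟨r, hr⟩ := rowMinK_isSome b hx hpole
  have h1 : casLBK b p = v + r := by simp [casLBK, hv, hr]
  have h2 : casLBKPlus b p = v' + r := by simp [casLBKPlus, hv', hr]
  rw [h1, h2]
  have := vbMin_le_vbPlus b hv hv'
  omega

end CasoratianK

end Summit.KontsevichZagierPeriods.Zeta5Search.DenomLaw.ThresholdModel.Rho
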